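import Mathlib
import HarnessLib
import Literature.Analysis.Calculus.SphereSpectralShell

/-!
# The Engel–Schaefer "natural derivative" on the site sphere: `∂̃f = (1 − x xᵀ)∇f`, the identity `−∂̃·∂̃ f = (d−1) x·∇f − tr[(1 − x xᵀ)H_f]`, its agreement with the spherical Laplacian, and linear functions as its eigenfunctions

HONEST FRAMING: exact (Metropolis-corrected) sampling algorithms for lattice gauge theory;
figures of merit are autocorrelation/cost numbers at stated couplings and volumes; no
continuum-physics claim.

Venture `LatticeQCDFlow` (cell pub-lqcd), topic `Exactness`; FANOUT row 7 (`s0-cpn-null`: the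
S0-D1 rung — 2D CP⁹, Lüscher's LO trivializing map inside HMC, Engel–Schaefer 2011).  NEW WORK of
the cell over Mathlib (`NormedSpace.normalize`, the Laplacian `Δ` of
`Mathlib.Analysis.InnerProductSpace.Laplacian`) and the Literature support file
`Literature/Analysis/Calculus/SphereSpectralShell.lean` (`angDeriv`, `sphLaplacian`, the angular
fields `L_{ij}` and `sum_sum_fderiv_fderiv_angularField`); nothing is cited as a fact.  Printed
counterpart, NAMED ONLY: Engel–Schaefer, Comput. Phys. Commun. 182 (2011) 2107, §2.2 eq. (12) (the
"natural derivative `∂̃ⁱf(x) = [(1 − x xᵀ)∇f(x)]_i` … corresponds to continuing `f` to the full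
`ℝ^{2N}` via `f̃(x) = f(x/|x|)` and then taking ordinary derivatives") and §3, the display before
eq. (15) ("on the unit sphere `−∂̃ⁱ∂̃ⁱf(x) = (2N−1) x·∇f(x) − tr[(1 − x xᵀ)H_f(x)]`").

## Content (`E` a real inner product space, `d = dim E`; `ν = NormedSpace.normalize`, `ν y = ‖y‖⁻¹ y`)

* §1 calculus of `ν`: `hasFDerivAt_norm_of_ne_zero`, **`hasFDerivAt_normalize`**
  (`Dν(y) h = ‖y‖⁻¹ (h − ⟪ν y, h⟫ ν y)`), `fderiv_normalize_apply_of_norm_eq_one`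
  (`Dν(x) = 1 − x xᵀ` on the unit sphere), `fderiv_normalize_apply_self` (`Dν(y) y = 0`),
  `fderiv_normalize_apply_angularField` (`Dν(y)(L_{ij} y) = L_{ij}(ν y)`: the angular fields are
  tangent), `contDiffAt_normalize`.
* §2 THE NATURAL DERIVATIVE (E–S eq. (12)): **`fderiv_comp_normalize`** — for `‖x‖ = 1`,
  `D(f ∘ ν)(x) h = Df(x)(h − ⟪x, h⟫ x)`, i.e. `∂̃f = (1 − x xᵀ)∇f`; the two Euler identities of the
  degree-`0` homogeneous extension, `fderiv_comp_normalize_apply_self` (`D(f∘ν)(y) y = 0`) and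
  `fderiv_fderiv_comp_normalize_self` (`D²(f∘ν)(x)(x, x) = 0`).
* §3 the second-order operator: `angDeriv_comp_normalize` (`∂_{L}(f∘ν) = (∂_{L} f)∘ν` off the
  origin), `angDeriv_angDeriv_comp_normalize`, **`sphLaplacian_comp_normalize`** (on the unit sphere
  the spherical Laplacian does not see the extension), `sphLaplacian_eq_laplacian`
  (`T q(x) = ‖x‖² Δq(x) − D²q(x)(x,x) − (d−1) Dq(x) x`, the Literature identity read through
  Mathlib's `Δ`), and THE E–S DISPLAY: **`laplacian_comp_normalize`** —
  `Δ(f∘ν)(x) = Δf(x) − D²f(x)(x,x) − (d−1)·Df(x) x` for `‖x‖ = 1` and `f` of class `C²` at `x`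
  (`tr[(1 − x xᵀ)H_f] = Δf − xᵀH_f x`), equivalently **`neg_laplacian_comp_normalize`**
  (`−∂̃·∂̃f = (d−1) x·∇f − tr[(1 − x xᵀ)H_f]`, the printed form with `d = 2N`), and
  **`laplacian_comp_normalize_eq_sphLaplacian`** (`∂̃·∂̃ f = T f`, the Literature's
  `½∑∂_{L_{ij}}²`, on the unit sphere: E–S's operator IS the Laplace–Beltrami operator).
* §4 **`laplacian_inner_comp_normalize`** — the restriction of an affine function `y ↦ ⟪J, y⟫ + c`
  to the unit sphere is an eigenfunction: `−∂̃·∂̃ (⟪J, ·⟫ + c)(x) = (d−1) ⟪J, x⟫`.  This is the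
  one-site computation behind E–S eq. (15) (`S̃⁽⁰⁾ = S / (2(2N−1))`): the CP(N−1) action is affine
  in each site variable separately (file `SphereLOFlowAction.lean`).

NOT CLAIMED: anything about the lattice action, the flow, or its Jacobian (the companion file); the
identification of `Δ(f∘ν)` with a Laplace–Beltrami operator of Mathlib's manifold library (none is
used; the Literature's `sphLaplacian` is the tree's spherical Laplacian); anything quantitative.
-/

noncomputable section

namespace Summit.Ventures.LatticeQCDFlow.Exactness

open NormedSpace Filter Laplacian Literature.Analysis.Calculus
open scoped RealInnerProductSpace Topology ContDiff

variable {E : Type*} [NormedAddCommGroup E] [InnerProductSpace ℝ E]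

/-! ## §1 Calculus of the radial retraction `ν y = ‖y‖⁻¹ • y` -/

section Normalize

/-- The norm of a real inner product space is differentiable off the origin with
`D‖·‖(y) h = ⟪y, h⟫ / ‖y‖`. -/
theorem hasFDerivAt_norm_of_ne_zero {y : E} (hy : y ≠ 0) :
    HasFDerivAt (fun z : E => ‖z‖) ((‖y‖⁻¹ : ℝ) • innerSL ℝ y) y := by
  have h1 : HasFDerivAt (fun z : E => ‖z‖ ^ 2) (2 • innerSL ℝ y) y :=
    (hasStrictFDerivAt_norm_sq y).hasFDerivAt
  have h2 : (‖y‖ ^ 2 : ℝ) ≠ 0 := pow_ne_zero _ (norm_ne_zero_iff.2 hy)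
  have h3 : HasFDerivAt (fun z : E => √(‖z‖ ^ 2)) ((1 / (2 * √(‖y‖ ^ 2))) • (2 • innerSL ℝ y)) y :=
    h1.sqrt h2
  simp only [Real.sqrt_sq_eq_abs, abs_norm] at h3
  convert h3 using 1
  ext h
  simp only [smul_apply, innerSL_apply_apply, smul_eq_mul, nsmul_eq_mul,
    Nat.cast_ofNat]
  field_simp

/-- **The derivative of the radial retraction** `ν y = ‖y‖⁻¹ • y` at `y ≠ 0`:
`Dν(y) h = ‖y‖⁻¹ • (h − ⟪ν y, h⟫ • ν y)` — the orthogonal projection onto the tangent space of the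
unit sphere at `ν y`, divided by `‖y‖`. -/
theorem hasFDerivAt_normalize {y : E} (hy : y ≠ 0) :
    HasFDerivAt (normalize : E → E)
      ((‖y‖⁻¹ : ℝ) • (ContinuousLinearMap.id ℝ E -
        (innerSL ℝ (normalize y)).smulRight (normalize y))) y := by
  have hn0 : (‖y‖ : ℝ) ≠ 0 := norm_ne_zero_iff.2 hy
  have hinv : HasFDerivAt (fun z : E => ‖z‖⁻¹)
      ((-(‖y‖ ^ 2)⁻¹ : ℝ) • ((‖y‖⁻¹ : ℝ) • innerSL ℝ y)) y :=
    (hasDerivAt_inv hn0).comp_hasFDerivAt y (hasFDerivAt_norm_of_ne_zero hy)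
  have h : HasFDerivAt (fun z : E => ‖z‖⁻¹ • z)
      (‖y‖⁻¹ • ContinuousLinearMap.id ℝ E +
        ((-(‖y‖ ^ 2)⁻¹ : ℝ) • ((‖y‖⁻¹ : ℝ) • innerSL ℝ y)).smulRight y) y :=
    hinv.smul (hasFDerivAt_id y)
  refine (show (normalize : E → E) = fun z => ‖z‖⁻¹ • z from rfl) ▸ h.congr_fderiv ?_
  ext h
  simp only [add_apply, smul_apply, ContinuousLinearMap.id_apply,
    ContinuousLinearMap.smulRight_apply, innerSL_apply_apply, sub_apply, real_inner_smul_left,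
    smul_sub, smul_smul]
  module

/-- `ν` is smooth off the origin. -/
theorem contDiffAt_normalize {y : E} (hy : y ≠ 0) {n : WithTop ℕ∞} :
    ContDiffAt ℝ n (normalize : E → E) y :=
  ((contDiffAt_norm ℝ hy).inv (norm_ne_zero_iff.2 hy)).smul contDiffAt_id

/-- `ν` is differentiable off the origin. -/
theorem differentiableAt_normalize {y : E} (hy : y ≠ 0) :
    DifferentiableAt ℝ (normalize : E → E) y :=
  (hasFDerivAt_normalize hy).differentiableAt

/-- `Dν(y) h = ‖y‖⁻¹ • (h − ⟪ν y, h⟫ • ν y)`, the `fderiv` form. -/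
theorem fderiv_normalize_apply {y : E} (hy : y ≠ 0) (h : E) :
    fderiv ℝ (normalize : E → E) y h = ‖y‖⁻¹ • (h - ⟪normalize y, h⟫ • normalize y) := by
  rw [(hasFDerivAt_normalize hy).fderiv]
  simp only [smul_apply, sub_apply,
    ContinuousLinearMap.id_apply, ContinuousLinearMap.smulRight_apply, innerSL_apply_apply]

/-- **On the unit sphere `Dν(x) = 1 − x xᵀ`**: `Dν(x) h = h − ⟪x, h⟫ • x` for `‖x‖ = 1`. -/
theorem fderiv_normalize_apply_of_norm_eq_one {x : E} (hx : ‖x‖ = 1) (h : E) :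
    fderiv ℝ (normalize : E → E) x h = h - ⟪x, h⟫ • x := by
  have hx0 : x ≠ 0 := by rintro rfl; simp at hx
  rw [fderiv_normalize_apply hx0, normalize_eq_self_of_norm_eq_one hx, hx, inv_one, one_smul]

/-- **Euler's relation for `ν`**: `Dν(y) y = 0` (the retraction is homogeneous of degree `0`). -/
theorem fderiv_normalize_apply_self {y : E} (hy : y ≠ 0) :
    fderiv ℝ (normalize : E → E) y y = 0 := by
  have hn0 : (‖y‖ : ℝ) ≠ 0 := norm_ne_zero_iff.2 hy
  rw [fderiv_normalize_apply hy]
  have h1 : ⟪NormedSpace.normalize y, y⟫ • NormedSpace.normalize y = y := by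
    simp only [NormedSpace.normalize, real_inner_smul_left, real_inner_self_eq_norm_sq, smul_smul]
    rw [show ‖y‖⁻¹ * ‖y‖ ^ 2 * ‖y‖⁻¹ = 1 by field_simp, one_smul]
  rw [h1, sub_self, smul_zero]

variable {ι : Type*} [Fintype ι]

/-- The angular fields are linear: `L_{ij}(r • y) = r • L_{ij} y`. -/
theorem angularField_smul (b : OrthonormalBasis ι ℝ E) (i j : ι) (r : ℝ) (y : E) :
    angularField b i j (r • y) = r • angularField b i j y := by
  simp only [angularField, real_inner_smul_left, smul_sub, smul_smul]

/-- **The angular fields are tangent to the spheres, in derivative form**: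
`Dν(y)(L_{ij} y) = L_{ij}(ν y)` for `y ≠ 0`. -/
theorem fderiv_normalize_apply_angularField (b : OrthonormalBasis ι ℝ E) (i j : ι) {y : E}
    (hy : y ≠ 0) :
    fderiv ℝ (normalize : E → E) y (angularField b i j y) = angularField b i j (normalize y) := by
  rw [fderiv_normalize_apply hy]
  have h0 : ⟪NormedSpace.normalize y, angularField b i j y⟫ = 0 := by
    rw [NormedSpace.normalize, real_inner_smul_left, real_inner_comm, inner_angularField_self,
      mul_zero]
  rw [h0, zero_smul, sub_zero, NormedSpace.normalize, angularField_smul]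

end Normalize

/-! ## §2 The natural derivative `∂̃f = (1 − x xᵀ)∇f` (E–S eq. (12)) and the Euler identities -/

section NaturalDerivative

variable {f : E → ℝ}

/-- **E–S eq. (12), the natural derivative.**  Continuing `f` to the ambient space by
`f̃(y) = f(y/‖y‖)` and differentiating: for `‖x‖ = 1`, `Df̃(x) h = Df(x)(h − ⟪x, h⟫ x)`, i.e.
`∇f̃(x) = (1 − x xᵀ)∇f(x)` is the tangential projection of the ordinary gradient. -/
theorem fderiv_comp_normalize {x : E} (hx : ‖x‖ = 1) (hf : DifferentiableAt ℝ f x) (h : E) :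
    fderiv ℝ (fun y => f (normalize y)) x h = fderiv ℝ f x (h - ⟪x, h⟫ • x) := by
  have hx0 : x ≠ 0 := by rintro rfl; simp at hx
  have hνx : normalize x = x := normalize_eq_self_of_norm_eq_one hx
  have hf' : DifferentiableAt ℝ f (normalize x) := by rwa [hνx]
  rw [fderiv_fun_comp x hf' (differentiableAt_normalize hx0)]
  simp only [ContinuousLinearMap.coe_comp, Function.comp_apply, hνx,
    fderiv_normalize_apply_of_norm_eq_one hx]

/-- **First Euler identity** of the degree-`0` homogeneous extension: `Df̃(y) y = 0` (`y ≠ 0`). -/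
theorem fderiv_comp_normalize_apply_self {y : E} (hy : y ≠ 0)
    (hf : DifferentiableAt ℝ f (normalize y)) :
    fderiv ℝ (fun z => f (normalize z)) y y = 0 := by
  rw [fderiv_fun_comp y hf (differentiableAt_normalize hy)]
  simp only [ContinuousLinearMap.coe_comp, Function.comp_apply, fderiv_normalize_apply_self hy,
    map_zero]

/-- Near a point `x ≠ 0` at which `f` is `C²` (at `ν x`), the points `z` are nonzero and `f` is
differentiable at `ν z`. -/
theorem eventually_differentiableAt_comp_normalize {x : E} (hx : x ≠ 0) {n : WithTop ℕ∞}
    (hf : ContDiffAt ℝ n f (normalize x)) (hn : n ≠ 0) (hn' : n ≠ ∞) :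
    ∀ᶠ z in 𝓝 x, z ≠ 0 ∧ DifferentiableAt ℝ f (normalize z) := by
  have h1 : ∀ᶠ z in 𝓝 x, z ≠ 0 := eventually_ne_nhds hx
  have h2 : ∀ᶠ w in 𝓝 (normalize x), ContDiffAt ℝ n f w := hf.eventually hn'
  have h3 : ∀ᶠ z in 𝓝 x, ContDiffAt ℝ n f (normalize z) :=
    (contDiffAt_normalize hx (n := n)).continuousAt.eventually h2
  filter_upwards [h1, h3] with z hz hz'
  exact ⟨hz, hz'.differentiableAt hn⟩

/-- The extension `f̃ = f ∘ ν` is `C^n` at `x ≠ 0` when `f` is `C^n` at `ν x`. -/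
theorem contDiffAt_comp_normalize {x : E} (hx : x ≠ 0) {n : WithTop ℕ∞}
    (hf : ContDiffAt ℝ n f (normalize x)) :
    ContDiffAt ℝ n (fun z => f (normalize z)) x :=
  hf.comp x (contDiffAt_normalize hx)

/-- **Second Euler identity**: `D²f̃(x)(x, x) = 0` for `x ≠ 0` and `f` of class `C²` at `ν x`
(differentiate `Df̃(z) z = 0` along `z`). -/
theorem fderiv_fderiv_comp_normalize_self {x : E} (hx : x ≠ 0)
    (hf : ContDiffAt ℝ 2 f (normalize x)) :
    fderiv ℝ (fderiv ℝ (fun z => f (normalize z))) x x x = 0 := by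
  set g : E → ℝ := fun z => f (normalize z) with hg
  have hg2 : ContDiffAt ℝ 2 g x := contDiffAt_comp_normalize hx hf
  have hdg : DifferentiableAt ℝ (fderiv ℝ g) x :=
    (hg2.fderiv_right (m := 1) (by norm_num)).differentiableAt (by norm_num)
  -- `φ(z) = Dg(z) z` vanishes near `x`
  have hφ : (fun z => fderiv ℝ g z z) =ᶠ[𝓝 x] fun _ => (0 : ℝ) := by
    filter_upwards [eventually_differentiableAt_comp_normalize hx hf (by norm_num) (by simp)]
      with z hz
    exact fderiv_comp_normalize_apply_self hz.1 hz.2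
  have h0 : fderiv ℝ (fun z => fderiv ℝ g z z) x x = 0 := by
    rw [hφ.fderiv_eq]; simp
  have h1 : fderiv ℝ (fun z => fderiv ℝ g z z) x x =
      fderiv ℝ (fderiv ℝ g) x x x + fderiv ℝ g x x := by
    rw [fderiv_clm_apply (u := fun z => z) hdg differentiableAt_id]
    simp [add_comm]
  have h2 : fderiv ℝ g x x = 0 :=
    fderiv_comp_normalize_apply_self hx (hf.differentiableAt (by norm_num))
  rw [h1, h2, add_zero] at h0
  exact h0

end NaturalDerivative

/-! ## §3 The second-order operator `∂̃·∂̃ f = Δ(f ∘ ν)` on the unit sphere -/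

section SecondOrder

variable {ι : Type*} [Fintype ι] {f : E → ℝ}

/-- **The angular derivatives do not see the extension**: `∂_{L_{ij}}(f∘ν)(y) = (∂_{L_{ij}}f)(ν y)`
for `y ≠ 0` (the angular fields are tangent and `ν` fixes directions). -/
theorem angDeriv_comp_normalize (b : OrthonormalBasis ι ℝ E) (i j : ι) {y : E} (hy : y ≠ 0)
    (hf : DifferentiableAt ℝ f (normalize y)) :
    angDeriv b i j (fun z => f (normalize z)) y = angDeriv b i j f (normalize y) := by
  unfold angDeriv
  rw [fderiv_fun_comp y hf (differentiableAt_normalize hy)]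
  simp only [ContinuousLinearMap.coe_comp, Function.comp_apply,
    fderiv_normalize_apply_angularField b i j hy]

/-- `∂_{L_{ij}} f` is differentiable at a point where `f` is `C²`. -/
theorem differentiableAt_angDeriv (b : OrthonormalBasis ι ℝ E) (i j : ι) {x : E}
    (hf : ContDiffAt ℝ 2 f x) : DifferentiableAt ℝ (angDeriv b i j f) x := by
  have hD : DifferentiableAt ℝ (fderiv ℝ f) x :=
    (hf.fderiv_right (m := 1) (by norm_num)).differentiableAt (by norm_num)
  have hL : DifferentiableAt ℝ (angularField b i j) x :=
    (hasFDerivAt_angularField b i j x).differentiableAt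
  exact hD.clm_apply hL

/-- **Second angular derivatives on the unit sphere do not see the extension**:
`∂_{L_{ij}}∂_{L_{ij}}(f∘ν)(x) = ∂_{L_{ij}}∂_{L_{ij}} f(x)` for `‖x‖ = 1`, `f ∈ C²` at `x`. -/
theorem angDeriv_angDeriv_comp_normalize (b : OrthonormalBasis ι ℝ E) (i j : ι) {x : E}
    (hx : ‖x‖ = 1) (hf : ContDiffAt ℝ 2 f x) :
    angDeriv b i j (angDeriv b i j (fun z => f (normalize z))) x =
      angDeriv b i j (angDeriv b i j f) x := by
  have hx0 : x ≠ 0 := by rintro rfl; simp at hx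
  have hνx : normalize x = x := normalize_eq_self_of_norm_eq_one hx
  have hf' : ContDiffAt ℝ 2 f (normalize x) := by rwa [hνx]
  -- near `x`, `∂_L (f∘ν) = (∂_L f) ∘ ν`
  have hev : angDeriv b i j (fun z => f (normalize z)) =ᶠ[𝓝 x]
      fun z => angDeriv b i j f (normalize z) := by
    filter_upwards [eventually_differentiableAt_comp_normalize hx0 hf' (by norm_num) (by simp)]
      with z hz
    exact angDeriv_comp_normalize b i j hz.1 hz.2
  have hda : DifferentiableAt ℝ (angDeriv b i j f) (normalize x) := by
    rw [hνx]; exact differentiableAt_angDeriv b i j hf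
  change fderiv ℝ (angDeriv b i j (fun z => f (normalize z))) x (angularField b i j x) =
    fderiv ℝ (angDeriv b i j f) x (angularField b i j x)
  rw [hev.fderiv_eq, fderiv_fun_comp x hda (differentiableAt_normalize hx0)]
  simp only [ContinuousLinearMap.coe_comp, Function.comp_apply,
    fderiv_normalize_apply_angularField b i j hx0, hνx]

/-- **The spherical Laplacian on the unit sphere does not see the extension**:
`T(f∘ν)(x) = T f(x)` for `‖x‖ = 1` and `f ∈ C²` at `x` (`T = ½∑∂_{L_{ij}}²`, the Literature's
`sphLaplacian`). -/
theorem sphLaplacian_comp_normalize (b : OrthonormalBasis ι ℝ E) {x : E} (hx : ‖x‖ = 1)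
    (hf : ContDiffAt ℝ 2 f x) :
    sphLaplacian b (fun z => f (normalize z)) x = sphLaplacian b f x := by
  unfold sphLaplacian
  congr 1
  refine Finset.sum_congr rfl fun i _ => Finset.sum_congr rfl fun j _ => ?_
  exact angDeriv_angDeriv_comp_normalize b i j hx hf

/-- `dim E = card ι` for an orthonormal basis indexed by `ι`. -/
theorem finrank_eq_card_orthonormalBasis (b : OrthonormalBasis ι ℝ E) :
    (Module.finrank ℝ E : ℝ) = Fintype.card ι := by
  rw [Module.finrank_eq_card_basis b.toBasis]

variable [FiniteDimensional ℝ E]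

/-- **The Literature identity read through Mathlib's Laplacian**: for `q ∈ C²` at `x`,
`T q(x) = ‖x‖² Δq(x) − D²q(x)(x, x) − (d − 1) Dq(x) x` with `d = dim E`
(`Literature.Analysis.Calculus.sum_sum_fderiv_fderiv_angularField`). -/
theorem sphLaplacian_eq_laplacian (b : OrthonormalBasis ι ℝ E) {q : E → ℝ} {x : E}
    (hq : ContDiffAt ℝ 2 q x) :
    sphLaplacian b q x = ‖x‖ ^ 2 * Δ q x - fderiv ℝ (fderiv ℝ q) x x x -
      ((Fintype.card ι : ℝ) - 1) * fderiv ℝ q x x := by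
  classical
  have hD : DifferentiableAt ℝ (fderiv ℝ q) x :=
    (hq.fderiv_right (m := 1) (by norm_num)).differentiableAt (by norm_num)
  unfold sphLaplacian angDeriv
  rw [sum_sum_fderiv_fderiv_angularField b hD,
    InnerProductSpace.laplacian_eq_iteratedFDeriv_orthonormalBasis q b]
  simp only [iteratedFDeriv_two_apply, Matrix.cons_val_zero, Matrix.cons_val_one]
  ring

/-- **The Engel–Schaefer display (before eq. (15)).**  For `‖x‖ = 1` and `f` of class `C²` at `x`,
the Laplacian of the extension `f̃(y) = f(y/‖y‖)` is
`Δf̃(x) = Δf(x) − D²f(x)(x, x) − (d − 1)·Df(x) x` (`d = dim E`; `Δf − xᵀH_f x = tr[(1 − x xᵀ)H_f]`). -/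
theorem laplacian_comp_normalize {x : E} (hx : ‖x‖ = 1) (hf : ContDiffAt ℝ 2 f x) :
    Δ (fun z => f (normalize z)) x = Δ f x - fderiv ℝ (fderiv ℝ f) x x x -
      ((Module.finrank ℝ E : ℝ) - 1) * fderiv ℝ f x x := by
  have hx0 : x ≠ 0 := by rintro rfl; simp at hx
  have hνx : normalize x = x := normalize_eq_self_of_norm_eq_one hx
  have hf' : ContDiffAt ℝ 2 f (normalize x) := by rwa [hνx]
  set b := stdOrthonormalBasis ℝ E
  have hg : ContDiffAt ℝ 2 (fun z => f (normalize z)) x := contDiffAt_comp_normalize hx0 hf'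
  have h1 := sphLaplacian_eq_laplacian b hg
  have h2 := sphLaplacian_eq_laplacian b hf
  rw [sphLaplacian_comp_normalize b hx hf, h2, fderiv_fderiv_comp_normalize_self hx0 hf',
    fderiv_comp_normalize_apply_self hx0 (hf'.differentiableAt (by norm_num)), hx] at h1
  rw [finrank_eq_card_orthonormalBasis b]
  linarith

/-- **E–S's printed form**: `−∂̃ⁱ∂̃ⁱ f(x) = (d − 1) x·∇f(x) − tr[(1 − x xᵀ) H_f(x)]` on the unit
sphere, with `tr[(1 − x xᵀ)H_f(x)] = Δf(x) − D²f(x)(x, x)` (for CP(N−1), `d = 2N`). -/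
theorem neg_laplacian_comp_normalize {x : E} (hx : ‖x‖ = 1) (hf : ContDiffAt ℝ 2 f x) :
    -Δ (fun z => f (normalize z)) x = ((Module.finrank ℝ E : ℝ) - 1) * fderiv ℝ f x x -
      (Δ f x - fderiv ℝ (fderiv ℝ f) x x x) := by
  rw [laplacian_comp_normalize hx hf]; ring

/-- **E–S's operator is the spherical Laplacian**: `∂̃·∂̃ f(x) = T f(x)` for `‖x‖ = 1`, `f ∈ C²`
at `x`, for every orthonormal frame (`T = ½∑ᵢⱼ∂_{L_{ij}}²`, `SphereSpectralShell.sphLaplacian`). -/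
theorem laplacian_comp_normalize_eq_sphLaplacian (b : OrthonormalBasis ι ℝ E) {x : E}
    (hx : ‖x‖ = 1) (hf : ContDiffAt ℝ 2 f x) :
    Δ (fun z => f (normalize z)) x = sphLaplacian b f x := by
  rw [laplacian_comp_normalize hx hf, sphLaplacian_eq_laplacian b hf, hx,
    finrank_eq_card_orthonormalBasis b]
  ring

end SecondOrder

/-! ## §4 Linear functions on the sphere are eigenfunctions: `−∂̃·∂̃ ⟪J, ·⟫ = (d − 1)⟪J, ·⟫` -/

section Eigen

/-- The derivative of the affine function `y ↦ ⟪J, y⟫ + c` is the constant form `⟪J, ·⟫`. -/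
theorem hasFDerivAt_inner_add_const (J : E) (c : ℝ) (y : E) :
    HasFDerivAt (fun z : E => ⟪J, z⟫ + c) (innerSL ℝ J) y := by
  have h : HasFDerivAt (fun z : E => innerSL ℝ J z) (innerSL ℝ J) y := (innerSL ℝ J).hasFDerivAt
  simpa only [innerSL_apply_apply] using h.add_const c

/-- `fderiv` of the affine function is the constant `innerSL ℝ J`. -/
theorem fderiv_inner_add_const (J : E) (c : ℝ) :
    fderiv ℝ (fun z : E => ⟪J, z⟫ + c) = fun _ => innerSL ℝ J :=
  funext fun y => (hasFDerivAt_inner_add_const J c y).fderiv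

/-- An affine function is smooth. -/
theorem contDiff_inner_add_const (J : E) (c : ℝ) {n : WithTop ℕ∞} :
    ContDiff ℝ n (fun z : E => ⟪J, z⟫ + c) := by
  have h : (fun z : E => ⟪J, z⟫ + c) = fun z => innerSL ℝ J z + c := by
    funext z; rw [innerSL_apply_apply]
  rw [h]
  exact (innerSL ℝ J).contDiff.add contDiff_const

variable [FiniteDimensional ℝ E]

/-- The flat Laplacian of an affine function vanishes. -/
theorem laplacian_inner_add_const (J : E) (c : ℝ) (x : E) :
    Δ (fun z : E => ⟪J, z⟫ + c) x = 0 := by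
  rw [InnerProductSpace.laplacian_eq_iteratedFDeriv_orthonormalBasis _ (stdOrthonormalBasis ℝ E)]
  simp [iteratedFDeriv_two_apply, fderiv_inner_add_const]

/-- **The one-site computation behind E–S eq. (15).**  The restriction of an affine function
`y ↦ ⟪J, y⟫ + c` to the unit sphere is an eigenfunction of `−∂̃·∂̃` with eigenvalue `d − 1`:
`Δ((⟪J, ·⟫ + c) ∘ ν)(x) = −(d − 1)⟪J, x⟫` for `‖x‖ = 1` (its Hessian vanishes and
`x·∇ = ⟪J, x⟫`).  For the CP(N−1) site sphere `d = 2N` and the eigenvalue is `2N − 1`. -/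
theorem laplacian_inner_comp_normalize {x : E} (hx : ‖x‖ = 1) (J : E) (c : ℝ) :
    Δ (fun z : E => ⟪J, normalize z⟫ + c) x = -(((Module.finrank ℝ E : ℝ) - 1) * ⟪J, x⟫) := by
  have h := laplacian_comp_normalize (f := fun z : E => ⟪J, z⟫ + c) hx
    (contDiff_inner_add_const J c).contDiffAt
  rw [h, laplacian_inner_add_const, fderiv_inner_add_const]
  simp [innerSL_apply_apply]

end Eigen

end Summit.Ventures.LatticeQCDFlow.Exactness

end
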